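import Mathlib
import Summits.HubbardSuperconductivity.HubbardSuperconductivity.Theorems.BalabanIRBirGappedPhaseReductionRBlockLondonStripStiffnessCase

/-!
# Route BalabanIR — crux 4R `BirGappedPhaseReductionR` (item `stmt-HubbardSuperconductivity-14846`):
# block-London coercivity IX — the Fermi-strip stiffness bound (hypothesis (K1))

THEOREM (`kernelSymbol_stiffness`).  For `μ ∈ (-4,4)` and a cone parameter `ε > 0` there are
`q₀, c₁, Δ₀ > 0` such that for all gaps `Δ₁, Δ₂ ≠ 0` with `|Δ₁| ≤ |Δ₂|/ε` and `|Δ₁| + |Δ₂| ≤ Δ₀`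
and all `L ≥ L₀(Δ)`, the structure factor of the anomalous-amplitude symbol `f = Δ/E` of the
`d+id` BdG reference obeys the gap-uniform STIFFNESS bound
  `c₁ ‖v‖²_∞ ≤ |Δ₂| · N⁻¹ Σ_k |f_k - f_{k+q}|²`
for every texture momentum `q` and every representative `v ≡ 2πq/L (mod 2π)` with
`‖v‖_∞ ≤ q₀ |Δ₂|`.  PROOF: restrict the `k`-sum to the Fermi strips near the two diagonal Fermi
points `(p*, p*)`, `(p*, 2π - p*)` (`cos p* = -μ/4`), whose normals span the plane
(`stiffness_case` of file `…StripStiffnessCase`, specialised in `stiffness_at_diag` /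
`stiffness_at_antidiag`; the lattice sum is identified with the strip functional in
`lattice_symbol_sum_eq`).  Together with (K2) (`kernelSymbol_pos_far`) this gives the kernel symbol
inequality on the cone `ε|Δ₂| ≤ |Δ₁| ≤ |Δ₂|/ε` and hence, through
`blockLondon_of_kernelSymbolIneq`, the block-London rigidity with a gap-independent constant
(file `…BlockLondonCone`).  No definition is introduced.
-/

noncomputable section

namespace Summit.HubbardSuperconductivity.HubbardSuperconductivity.Theorems

namespace BirBdG

open Finset Literature.Probability.LatticeModels

/-- The lattice structure-factor summand is the strip functional of the continuum symbol at the
displacement `v ≡ 2πq/L`. [folklore] -/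
theorem lattice_symbol_sum_eq (L : ℕ) [NeZero L] (μ Δ₁ Δ₂ : ℝ) (fc : (Fin 2 → ℝ) → ℂ)
    (hfc : ∀ p, fc p = (((2 * Δ₁ * (Real.cos (p 0) - Real.cos (p 1)) : ℝ) : ℂ) -
        4 * Complex.I * ((Δ₂ * Real.sin (p 0) * Real.sin (p 1) : ℝ) : ℂ)) /
      ((Real.sqrt ((-2 * Real.cos (p 0) - 2 * Real.cos (p 1) - μ) ^ 2 +
        ‖((2 * Δ₁ * (Real.cos (p 0) - Real.cos (p 1)) : ℝ) : ℂ) -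
          4 * Complex.I * ((Δ₂ * Real.sin (p 0) * Real.sin (p 1) : ℝ) : ℂ)‖ ^ 2) : ℝ) : ℂ))
    (ξ E : TorusSite 2 L → ℝ) (Δ : TorusSite 2 L → ℂ)
    (hξ : ∀ k, ξ k = -2 * Real.cos (latticeMomentum L k 0) - 2 * Real.cos (latticeMomentum L k 1) - μ)
    (hΔ : ∀ k, Δ k = ((2 * Δ₁ * (Real.cos (latticeMomentum L k 0) - Real.cos (latticeMomentum L k 1)) : ℝ) : ℂ) -
      4 * Complex.I * ((Δ₂ * Real.sin (latticeMomentum L k 0) * Real.sin (latticeMomentum L k 1) : ℝ) : ℂ))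
    (hE : ∀ k, E k = Real.sqrt (ξ k ^ 2 + ‖Δ k‖ ^ 2)) (q : TorusSite 2 L) (v : Fin 2 → ℝ)
    (hv : ∀ i, ∃ n : ℤ, v i = latticeMomentum L q i + 2 * Real.pi * n) :
    ∑ k : TorusSite 2 L, ‖Δ k / (E k : ℂ) - Δ (k + q) / (E (k + q) : ℂ)‖ ^ 2 =
      ∑ k : TorusSite 2 L, ‖fc (latticeMomentum L k) - fc (latticeMomentum L k + v)‖ ^ 2 := by
  have hper := symbolC_periodic μ Δ₁ Δ₂ fc hfc
  choose m hm using hv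
  refine Finset.sum_congr rfl fun k _ => ?_
  obtain ⟨n, hn⟩ := latticeMomentum_add_eq k q
  have e1 : Δ k / (E k : ℂ) = fc (latticeMomentum L k) := by
    rw [hfc, hE, hξ, hΔ]
  have hvP : latticeMomentum L k + v =
      fun i => (latticeMomentum L k + latticeMomentum L q) i + 2 * Real.pi * (m i : ℝ) := by
    funext i; simp only [Pi.add_apply, hm i]; ring
  have e2 : Δ (k + q) / (E (k + q) : ℂ) = fc (latticeMomentum L k + v) := by
    rw [hvP, hper, ← hper (latticeMomentum L k + latticeMomentum L q) n, hfc, hE, hξ, hΔ, hn]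
    simp only [Pi.add_apply]
  rw [e1, e2]

/-- `stiffness_case` at the diagonal Fermi point `(p*, p*)` with signs `(1, 1)`. [folklore] -/
theorem stiffness_at_diag (L : ℕ) [NeZero L] (μ Δ₁ Δ₂ S D ρ pstar : ℝ) (v : Fin 2 → ℝ)
    (fc : (Fin 2 → ℝ) → ℂ)
    (hfc : ∀ p, fc p = (((2 * Δ₁ * (Real.cos (p 0) - Real.cos (p 1)) : ℝ) : ℂ) -
        4 * Complex.I * ((Δ₂ * Real.sin (p 0) * Real.sin (p 1) : ℝ) : ℂ)) /
      ((Real.sqrt ((-2 * Real.cos (p 0) - 2 * Real.cos (p 1) - μ) ^ 2 +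
        ‖((2 * Δ₁ * (Real.cos (p 0) - Real.cos (p 1)) : ℝ) : ℂ) -
          4 * Complex.I * ((Δ₂ * Real.sin (p 0) * Real.sin (p 1) : ℝ) : ℂ)‖ ^ 2) : ℝ) : ℂ))
    (hcos : -4 * Real.cos pstar - μ = 0) (hS : Real.sin pstar = S) (hSpos : 0 < S)
    (hρ : 0 < ρ) (h16ρ : 16 * ρ ≤ S) (hD : D = 4 * |Δ₂| * S ^ 2) (hDpos : 0 < D)
    (hρD : (2 * |Δ₁| + 4 * |Δ₂|) * (4 * ρ) ≤ D / 10) (hsmall : 2 * |Δ₁| + 4 * |Δ₂| ≤ S / 22)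
    (hDρ : 18 / 10 * D ≤ ρ * S / 4) (hrange : ρ ≤ pstar ∧ pstar + ρ < 2 * Real.pi)
    (hvρ : ∀ i, |v i| ≤ ρ) (hvD : ∀ i, |v i| ≤ D / 40)
    (hw : ∀ i, |2 * Real.sin (v i / 2)| ≤ |2 * Real.sin (v 0 / 2) + 2 * Real.sin (v 1 / 2)|)
    (hL1 : 64 / D ≤ L) (hL2 : 64 / (ρ * S) ≤ L) :
    (ρ * S * L / 64) * (D * L / 16) * (S * |2 * Real.sin (v 0 / 2) + 2 * Real.sin (v 1 / 2)| / (572 * D)) ^ 2 ≤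
      ∑ k : TorusSite 2 L, ‖fc (latticeMomentum L k) - fc (latticeMomentum L k + v)‖ ^ 2 := by
  have hS1 : S ≤ 1 := hS ▸ Real.sin_le_one _
  obtain ⟨b, hb⟩ : ∃ b : Fin 2 → ℝ, b = ![pstar, pstar] := ⟨_, rfl⟩
  obtain ⟨σ, hσ_def⟩ : ∃ σ : Fin 2 → ℝ, σ = ![1, 1] := ⟨_, rfl⟩
  have hσ : ∀ i, σ i = 1 ∨ σ i = -1 := fun i => by fin_cases i <;> simp [hσ_def]
  have hS' : ∀ i, σ i * Real.sin (b i) = S := fun i => by fin_cases i <;> simp [hσ_def, hb, hS]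
  have hsin0 : Real.sin (b 0) = S := by simp [hb, hS]
  have hb0 : -2 * Real.cos (b 0) - 2 * Real.cos (b 1) - μ = 0 := by
    simp only [hb, Matrix.cons_val_zero, Matrix.cons_val_one, Matrix.cons_val_fin_one]; linarith
  have hDb : ‖(((2 * Δ₁ * (Real.cos (b 0) - Real.cos (b 1)) : ℝ) : ℂ) -
      4 * Complex.I * ((Δ₂ * Real.sin (b 0) * Real.sin (b 1) : ℝ) : ℂ))‖ = D := by
    have e : (((2 * Δ₁ * (Real.cos (b 0) - Real.cos (b 1)) : ℝ) : ℂ) -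
        4 * Complex.I * ((Δ₂ * Real.sin (b 0) * Real.sin (b 1) : ℝ) : ℂ)) =
        -(4 * Complex.I * ((Δ₂ * S * S : ℝ) : ℂ)) := by
      rw [hb]; simp [hS]
    rw [e, norm_neg, norm_mul, norm_mul, Complex.norm_I, Complex.norm_real, Real.norm_eq_abs,
      abs_mul, abs_mul, abs_of_pos hSpos, hD]
    norm_num [Complex.norm_ofNat]; ring
  have hw' : ∀ i, |2 * Real.sin (v i / 2)| ≤ |σ 0 * (2 * Real.sin (v 0 / 2)) + σ 1 * (2 * Real.sin (v 1 / 2))| := by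
    intro i; simpa [hσ_def] using hw i
  have hrange0 : ρ ≤ b 0 ∧ b 0 + ρ < 2 * Real.pi := by simpa [hb] using hrange
  have hrange1 : ρ * S / 8 ≤ b 1 ∧ b 1 + ρ * S / 8 < 2 * Real.pi := by
    have h1 : ρ * S ≤ ρ * 1 := mul_le_mul_of_nonneg_left hS1 hρ.le
    simp only [hb, Matrix.cons_val_one, Matrix.cons_val_fin_one]
    exact ⟨by linarith [hrange.1], by linarith [hrange.2]⟩
  have h := stiffness_case L μ Δ₁ Δ₂ S D ρ σ b v fc hfc hσ hS' hsin0 hSpos hρ h16ρ hb0 hDb hDpos hρD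
    hsmall hDρ hrange0 hrange1 hvρ hvD hw' hL1 hL2
  simpa [hσ_def] using h

/-- `stiffness_case` at the anti-diagonal Fermi point `(p*, 2π - p*)` with signs `(1, -1)`.
[folklore] -/
theorem stiffness_at_antidiag (L : ℕ) [NeZero L] (μ Δ₁ Δ₂ S D ρ pstar : ℝ) (v : Fin 2 → ℝ)
    (fc : (Fin 2 → ℝ) → ℂ)
    (hfc : ∀ p, fc p = (((2 * Δ₁ * (Real.cos (p 0) - Real.cos (p 1)) : ℝ) : ℂ) -
        4 * Complex.I * ((Δ₂ * Real.sin (p 0) * Real.sin (p 1) : ℝ) : ℂ)) /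
      ((Real.sqrt ((-2 * Real.cos (p 0) - 2 * Real.cos (p 1) - μ) ^ 2 +
        ‖((2 * Δ₁ * (Real.cos (p 0) - Real.cos (p 1)) : ℝ) : ℂ) -
          4 * Complex.I * ((Δ₂ * Real.sin (p 0) * Real.sin (p 1) : ℝ) : ℂ)‖ ^ 2) : ℝ) : ℂ))
    (hcos : -4 * Real.cos pstar - μ = 0) (hS : Real.sin pstar = S) (hSpos : 0 < S)
    (hρ : 0 < ρ) (h16ρ : 16 * ρ ≤ S) (hD : D = 4 * |Δ₂| * S ^ 2) (hDpos : 0 < D)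
    (hρD : (2 * |Δ₁| + 4 * |Δ₂|) * (4 * ρ) ≤ D / 10) (hsmall : 2 * |Δ₁| + 4 * |Δ₂| ≤ S / 22)
    (hDρ : 18 / 10 * D ≤ ρ * S / 4) (hrange : ρ ≤ pstar ∧ pstar + ρ < 2 * Real.pi)
    (hpπ : pstar < Real.pi) (hSle : S ≤ pstar)
    (hvρ : ∀ i, |v i| ≤ ρ) (hvD : ∀ i, |v i| ≤ D / 40)
    (hw : ∀ i, |2 * Real.sin (v i / 2)| ≤ |2 * Real.sin (v 0 / 2) - 2 * Real.sin (v 1 / 2)|)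
    (hL1 : 64 / D ≤ L) (hL2 : 64 / (ρ * S) ≤ L) :
    (ρ * S * L / 64) * (D * L / 16) * (S * |2 * Real.sin (v 0 / 2) - 2 * Real.sin (v 1 / 2)| / (572 * D)) ^ 2 ≤
      ∑ k : TorusSite 2 L, ‖fc (latticeMomentum L k) - fc (latticeMomentum L k + v)‖ ^ 2 := by
  have hS1 : S ≤ 1 := hS ▸ Real.sin_le_one _
  obtain ⟨b, hb⟩ : ∃ b : Fin 2 → ℝ, b = ![pstar, 2 * Real.pi - pstar] := ⟨_, rfl⟩
  obtain ⟨σ, hσ_def⟩ : ∃ σ : Fin 2 → ℝ, σ = ![1, -1] := ⟨_, rfl⟩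
  have hσ : ∀ i, σ i = 1 ∨ σ i = -1 := fun i => by fin_cases i <;> simp [hσ_def]
  have hS' : ∀ i, σ i * Real.sin (b i) = S := fun i => by
    fin_cases i
    · simp [hσ_def, hb, hS]
    · simp [hσ_def, hb, hS, Real.sin_two_pi_sub]
  have hsin0 : Real.sin (b 0) = S := by simp [hb, hS]
  have hb0 : -2 * Real.cos (b 0) - 2 * Real.cos (b 1) - μ = 0 := by
    simp only [hb, Matrix.cons_val_zero, Matrix.cons_val_one, Matrix.cons_val_fin_one,
      Real.cos_two_pi_sub]; linarith
  have hDb : ‖(((2 * Δ₁ * (Real.cos (b 0) - Real.cos (b 1)) : ℝ) : ℂ) -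
      4 * Complex.I * ((Δ₂ * Real.sin (b 0) * Real.sin (b 1) : ℝ) : ℂ))‖ = D := by
    have e : (((2 * Δ₁ * (Real.cos (b 0) - Real.cos (b 1)) : ℝ) : ℂ) -
        4 * Complex.I * ((Δ₂ * Real.sin (b 0) * Real.sin (b 1) : ℝ) : ℂ)) =
        4 * Complex.I * ((Δ₂ * S * S : ℝ) : ℂ) := by
      rw [hb]; simp [hS, Real.cos_two_pi_sub, Real.sin_two_pi_sub]
    rw [e, norm_mul, norm_mul, Complex.norm_I, Complex.norm_real, Real.norm_eq_abs,
      abs_mul, abs_mul, abs_of_pos hSpos, hD]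
    norm_num [Complex.norm_ofNat]; ring
  have hw' : ∀ i, |2 * Real.sin (v i / 2)| ≤ |σ 0 * (2 * Real.sin (v 0 / 2)) + σ 1 * (2 * Real.sin (v 1 / 2))| := by
    intro i
    have e : σ 0 * (2 * Real.sin (v 0 / 2)) + σ 1 * (2 * Real.sin (v 1 / 2)) =
        2 * Real.sin (v 0 / 2) - 2 * Real.sin (v 1 / 2) := by simp [hσ_def]; ring
    rw [e]; exact hw i
  have hrange0 : ρ ≤ b 0 ∧ b 0 + ρ < 2 * Real.pi := by simpa [hb] using hrange
  have hrange1 : ρ * S / 8 ≤ b 1 ∧ b 1 + ρ * S / 8 < 2 * Real.pi := by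
    have h1 : ρ * S ≤ ρ * 1 := mul_le_mul_of_nonneg_left hS1 hρ.le
    simp only [hb, Matrix.cons_val_one, Matrix.cons_val_fin_one]
    constructor
    · linarith [hrange.1]
    · have : ρ * S / 8 < pstar := by linarith
      linarith
  have h := stiffness_case L μ Δ₁ Δ₂ S D ρ σ b v fc hfc hσ hS' hsin0 hSpos hρ h16ρ hb0 hDb hDpos hρD
    hsmall hDρ hrange0 hrange1 hvρ hvD hw' hL1 hL2
  have e : σ 0 * (2 * Real.sin (v 0 / 2)) + σ 1 * (2 * Real.sin (v 1 / 2)) =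
      2 * Real.sin (v 0 / 2) - 2 * Real.sin (v 1 / 2) := by simp [hσ_def]; ring
  rw [e] at h
  exact h

/-- **The Fermi-strip stiffness bound (hypothesis (K1) of the kernel symbol inequality).**
See the module docstring. [folklore] -/
theorem kernelSymbol_stiffness : ∀ (μ ε : ℝ), μ ∈ Set.Ioo (-4 : ℝ) 4 → 0 < ε → ∃ q₀ c₁ Δ₀ : ℝ, 0 < q₀ ∧ 0 < c₁ ∧ 0 < Δ₀ ∧ ∀ (Δ₁ Δ₂ : ℝ), Δ₁ ≠ 0 → Δ₂ ≠ 0 → |Δ₁| ≤ |Δ₂| / ε → |Δ₁| + |Δ₂| ≤ Δ₀ → ∃ L₀ : ℕ, ∀ (L : ℕ) [NeZero L], L₀ ≤ L → ∀ (ξ E : Literature.Probability.LatticeModels.TorusSite 2 L → ℝ) (Δ : Literature.Probability.LatticeModels.TorusSite 2 L → ℂ), (∀ k, ξ k = -2 * Real.cos (Literature.Probability.LatticeModels.latticeMomentum L k 0) - 2 * Real.cos (Literature.Probability.LatticeModels.latticeMomentum L k 1) - μ) → (∀ k, Δ k = ((2 * Δ₁ * (Real.cos (Literature.Probability.LatticeModels.latticeMomentum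 L k 0) - Real.cos (Literature.Probability.LatticeModels.latticeMomentum L k 1)) : ℝ) : ℂ) - 4 * Complex.I * ((Δ₂ * Real.sin (Literature.Probability.LatticeModels.latticeMomentum L k 0) * Real.sin (Literature.Probability.LatticeModels.latticeMomentum L k 1) : ℝ) : ℂ)) → (∀ k, E k = Real.sqrt (ξ k ^ 2 + ‖Δ k‖ ^ 2)) → ∀ (q : Literature.Probability.LatticeModels.TorusSite 2 L) (v : Fin 2 → ℝ), (∀ i, ∃ n : ℤ, v i = Literature.Probability.LatticeModels.latticeMomentum L q i + 2 * Real.pi * n) → (∀ i, |v i| ≤ q₀ * |Δ₂|) → c₁ * (max |v 0| |v 1|) ^ 2 ≤ |Δ₂| * (((L ^ 2 : ℕ) : ℝ)⁻¹ * ∑ k : Literature.Probability.LatticeModels.TorusSite 2 L, ‖Δ k / (E k : ℂ) - Δ (k + q) / (E (k + q) : ℂ)‖ ^ 2) := by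
  intro μ ε hμ hε
  have hπ3 := Real.pi_gt_three
  -- the Fermi angle on the diagonal (all constants as opaque reals with defining equations)
  obtain ⟨x, hx⟩ : ∃ x : ℝ, x = -μ / 4 := ⟨_, rfl⟩
  have hx1 : -1 < x := by rw [hx]; linarith [hμ.2]
  have hx2 : x < 1 := by rw [hx]; linarith [hμ.1]
  obtain ⟨pstar, hpstar⟩ : ∃ pstar : ℝ, pstar = Real.arccos x := ⟨_, rfl⟩
  have hcosx : Real.cos pstar = x := by rw [hpstar]; exact Real.cos_arccos hx1.le hx2.le
  have hcos : -4 * Real.cos pstar - μ = 0 := by rw [hcosx, hx]; ring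
  obtain ⟨S, hS_def⟩ : ∃ S : ℝ, S = Real.sin pstar := ⟨_, rfl⟩
  have hSpos : 0 < S := by
    rw [hS_def, hpstar, Real.sin_arccos]
    exact Real.sqrt_pos.2 (by nlinarith)
  have hS1 : S ≤ 1 := by rw [hS_def]; exact Real.sin_le_one _
  have hp0 : 0 < pstar := by rw [hpstar]; exact Real.arccos_pos.2 hx2
  have hpπ : pstar < Real.pi := by rw [hpstar]; exact Real.arccos_lt_pi.2 hx1
  have hSle : S ≤ pstar := by rw [hS_def]; exact Real.sin_le hp0.le
  -- constants
  obtain ⟨K, hK⟩ : ∃ K : ℝ, K = 2 / ε + 4 := ⟨_, rfl⟩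
  have hKpos : 0 < K := by rw [hK]; positivity
  obtain ⟨ρ, hρ_def⟩ : ∃ ρ : ℝ, ρ = min (S / 16) (S ^ 2 / (10 * K)) := ⟨_, rfl⟩
  have hρpos : 0 < ρ := by rw [hρ_def]; exact lt_min (by positivity) (by positivity)
  have h16ρ : 16 * ρ ≤ S := by
    have : ρ ≤ S / 16 := by rw [hρ_def]; exact min_le_left _ _
    linarith
  have hρK : ρ ≤ S ^ 2 / (10 * K) := by rw [hρ_def]; exact min_le_right _ _
  have hρS : ρ < S := by linarith
  have hρ1 : ρ ≤ 1 := by linarith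
  obtain ⟨q₀, hq₀⟩ : ∃ q₀ : ℝ, q₀ = S ^ 2 / 10 := ⟨_, rfl⟩
  obtain ⟨c₁, hc₁⟩ : ∃ c₁ : ℝ, c₁ = ρ * S / (6 * 10 ^ 9) := ⟨_, rfl⟩
  obtain ⟨Δ₀, hΔ₀⟩ : ∃ Δ₀ : ℝ, Δ₀ = min (S / 88) (ρ / 30) := ⟨_, rfl⟩
  have hq₀pos : 0 < q₀ := by rw [hq₀]; positivity
  have hc₁pos : 0 < c₁ := by rw [hc₁]; positivity
  have hΔ₀pos : 0 < Δ₀ := by rw [hΔ₀]; exact lt_min (by positivity) (by positivity)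
  refine ⟨q₀, c₁, Δ₀, hq₀pos, hc₁pos, hΔ₀pos, ?_⟩
  intro Δ₁ Δ₂ h₁ h₂ hcone hΔsmall
  have hΔ₀1 : |Δ₁| + |Δ₂| ≤ S / 88 := hΔsmall.trans (by rw [hΔ₀]; exact min_le_left _ _)
  have hΔ₀2 : |Δ₁| + |Δ₂| ≤ ρ / 30 := hΔsmall.trans (by rw [hΔ₀]; exact min_le_right _ _)
  have hΔ₂pos : 0 < |Δ₂| := abs_pos.2 h₂
  have ha1 := abs_nonneg Δ₁
  obtain ⟨D, hD_def⟩ : ∃ D : ℝ, D = 4 * |Δ₂| * S ^ 2 := ⟨_, rfl⟩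
  have hDpos : 0 < D := by rw [hD_def]; exact mul_pos (mul_pos (by norm_num) hΔ₂pos) (pow_pos hSpos 2)
  -- (P2) `C · 4ρ ≤ D/10`
  have hCK : 2 * |Δ₁| + 4 * |Δ₂| ≤ K * |Δ₂| := by
    rw [hK]
    have : 2 * |Δ₁| ≤ 2 / ε * |Δ₂| := by
      rw [div_mul_eq_mul_div, le_div_iff₀ hε]
      have := hcone; rw [le_div_iff₀ hε] at this; linarith
    linarith
  have hρD : (2 * |Δ₁| + 4 * |Δ₂|) * (4 * ρ) ≤ D / 10 := by
    calc (2 * |Δ₁| + 4 * |Δ₂|) * (4 * ρ) ≤ (K * |Δ₂|) * (4 * (S ^ 2 / (10 * K))) := by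
          apply mul_le_mul hCK (by linarith) (by linarith) (mul_nonneg hKpos.le (abs_nonneg _))
      _ = D / 10 := by rw [hD_def]; field_simp
  -- (P3) `C ≤ S/22`
  have hsmall : 2 * |Δ₁| + 4 * |Δ₂| ≤ S / 22 := by linarith
  -- (P4) `1.8 D ≤ ρ S / 4`
  have hDρ : 18 / 10 * D ≤ ρ * S / 4 := by
    rw [hD_def]
    have hb1 : |Δ₂| ≤ ρ / 30 := by linarith
    have hb2 : S ^ 2 ≤ S := by nlinarith
    have hb3 : 4 * |Δ₂| * S ^ 2 ≤ 4 * (ρ / 30) * S :=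
      mul_le_mul (by linarith) hb2 (sq_nonneg _) (by linarith)
    nlinarith
  -- the side threshold
  refine ⟨max ⌈64 / D⌉₊ ⌈64 / (ρ * S)⌉₊, fun L _ hL ξ E Δ hξ hΔ hE q v hv hvq => ?_⟩
  have hLpos : (0 : ℝ) < L := by exact_mod_cast Nat.pos_of_ne_zero (NeZero.ne L)
  have hL1 : 64 / D ≤ L :=
    (Nat.le_ceil _).trans (by exact_mod_cast le_trans (le_max_left _ _) hL)
  have hL2 : 64 / (ρ * S) ≤ L :=
    (Nat.le_ceil _).trans (by exact_mod_cast le_trans (le_max_right _ _) hL)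
  -- (P5) the displacement is small
  have hvD : ∀ i, |v i| ≤ D / 40 := fun i => by
    refine (hvq i).trans (le_of_eq ?_); rw [hq₀, hD_def]; ring
  have hvρ : ∀ i, |v i| ≤ ρ := fun i => by
    refine (hvq i).trans ?_
    have hb1 : |Δ₂| ≤ ρ / 30 := by linarith
    have hq1 : q₀ ≤ 1 := by rw [hq₀]; nlinarith
    calc q₀ * |Δ₂| ≤ 1 * (ρ / 30) := mul_le_mul hq1 hb1 (abs_nonneg _) zero_le_one
      _ ≤ ρ := by linarith
  have hv1 : ∀ i, |v i| ≤ 1 := fun i => (hvρ i).trans hρ1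
  have hrange : ρ ≤ pstar ∧ pstar + ρ < 2 * Real.pi := ⟨by linarith, by linarith⟩
  -- the continuum symbol and the lattice sum
  obtain ⟨fc, hfc⟩ : ∃ fc : (Fin 2 → ℝ) → ℂ, ∀ p, fc p =
      (((2 * Δ₁ * (Real.cos (p 0) - Real.cos (p 1)) : ℝ) : ℂ) -
        4 * Complex.I * ((Δ₂ * Real.sin (p 0) * Real.sin (p 1) : ℝ) : ℂ)) /
      ((Real.sqrt ((-2 * Real.cos (p 0) - 2 * Real.cos (p 1) - μ) ^ 2 +
        ‖((2 * Δ₁ * (Real.cos (p 0) - Real.cos (p 1)) : ℝ) : ℂ) -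
          4 * Complex.I * ((Δ₂ * Real.sin (p 0) * Real.sin (p 1) : ℝ) : ℂ)‖ ^ 2) : ℝ) : ℂ) :=
    ⟨_, fun p => rfl⟩
  rw [lattice_symbol_sum_eq L μ Δ₁ Δ₂ fc hfc ξ E Δ hξ hΔ hE q v hv]
  have hN : ((L ^ 2 : ℕ) : ℝ) = (L : ℝ) ^ 2 := by push_cast; ring
  rw [hN]
  have hη0 : 0 ≤ max |v 0| |v 1| := le_max_of_le_left (abs_nonneg _)
  rcases abs_le_abs_add_or_sub (2 * Real.sin (v 0 / 2)) (2 * Real.sin (v 1 / 2)) with hA | hB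
  · have hw : ∀ i, |2 * Real.sin (v i / 2)| ≤ |2 * Real.sin (v 0 / 2) + 2 * Real.sin (v 1 / 2)| :=
      fun i => by fin_cases i <;> [exact hA.1; exact hA.2]
    have hcase := stiffness_at_diag L μ Δ₁ Δ₂ S D ρ pstar v fc hfc hcos hS_def.symm hSpos hρpos h16ρ
      hD_def hDpos hρD hsmall hDρ hrange hvρ hvD hw hL1 hL2
    exact stiffness_finish ρ S D |Δ₂| L c₁ _ _ _ hD_def hΔ₂pos hSpos hρpos hLpos hc₁ hη0
      (max_abs_le_two_mul_abs hv1 hw) hcase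
  · have hw : ∀ i, |2 * Real.sin (v i / 2)| ≤ |2 * Real.sin (v 0 / 2) - 2 * Real.sin (v 1 / 2)| :=
      fun i => by fin_cases i <;> [exact hB.1; exact hB.2]
    have hcase := stiffness_at_antidiag L μ Δ₁ Δ₂ S D ρ pstar v fc hfc hcos hS_def.symm hSpos hρpos
      h16ρ hD_def hDpos hρD hsmall hDρ hrange hpπ hSle hvρ hvD hw hL1 hL2
    exact stiffness_finish ρ S D |Δ₂| L c₁ _ _ _ hD_def hΔ₂pos hSpos hρpos hLpos hc₁ hη0
      (max_abs_le_two_mul_abs hv1 hw) hcase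

end BirBdG

end Summit.HubbardSuperconductivity.HubbardSuperconductivity.Theorems

end
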